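import Summits.AnomalousDissipation.AnomalousDissipation.Theses.Sparks
import Literature.Analysis.FluidPDE.NSHopfExistenceProofs
import Literature.Analysis.FunctionSpaces.TorusFluidGlueProofs

/-!
# Crux `SingularitiesDissipate` (stmt-AnomalousDissipation-1185, route Sparks, rank 3) — the strategist's typed split

Glue for the DECOMPOSITION of the crux
`Summit.AnomalousDissipation.AnomalousDissipation.Theses.Sparks.SingularitiesDissipate` along its HYPOTHESIS
(crux-strategist seat `cstrat-stmt-AnomalousDissipation-1185-s1`, 2026-08-17; census
`Cruxes/SingularitiesDissipate/STRATEGY-CENSUS.md`). The registered line `Lines/birth.lean` cuts the CONCLUSION of the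
crux (LIFESPAN ∣ SINGULARITIES DRAIN ENERGY ∣ THE DRAIN IS VISCOUS); this split is orthogonal to it and cuts the
HYPOTHESIS: a blow-up at ONE smooth datum `U₀` is first promoted to a blow-up on a whole `L²`-BALL of smooth data around
`U₀` (child 1, pure Euler), and ignition is then asked only at centres of such balls (child 2, the Onsager core in the
form the route actually consumes — `IgnitionReturnGlue` applies the crux only at smooth points of the blow-up ball of
`RecurrentBlowupBall`, each of which is itself the centre of a smaller blow-up ball).

CHILDREN (the two hypotheses of `singularitiesDissipate_of_subs`, verbatim the `statement`s filed with
`ledger route edit route-AnomalousDissipation-Sparks --split SingularitiesDissipate`):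

* `BlowupIsL2Open` — BREAKDOWN IS `L²`-ROBUST WITH DELAY (pure Euler, open): if smooth steadily-forced Euler on `T³` from
  the smooth divergence-free `U₀` has no classical solution on `[0,T]`, then for some delay `τ ≥ 0` and radius `r > 0`
  NO smooth divergence-free `V` with `‖V − U₀‖_{L²} ≤ r` launches a classical solution on `[0, T+τ]`. This is the typed
  form of the crux's failure mode (iii) "`L²`-small, gradient-large perturbations defusing the singularity", and it is a
  NECESSARY condition: `blowupIsL2Open_of_singularitiesDissipate` below derives it from the crux, the route's support
  `WindowStability` (stmt-1186, the Bruè–De Lellis relative-energy engine) and Hopf's existence theorem (discharged,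
  `Literature.Analysis.FluidPDE.hopf_existence_torus_holds`) — the off-centre form of the route's `BreakdownOfIgnition`.
* `BallIgnition` — ROBUST BLOW-UP BALLS IGNITE AT THE CENTRE (Navier–Stokes, open; the Onsager core): if EVERY smooth
  divergence-free `V` in the closed `L²`-ball of radius `r` about `U₀` fails to launch a classical forced-Euler solution
  on `[0,S]`, then there are `q > 0`, `τ ≥ 0`, `ν₀ > 0`, `δ > 0` such that every global Leray–Hopf solution of `NS_ν`,
  `ν < ν₀`, from a finite-energy datum `δ`-close to `U₀` burns `q ≤ ν∫₀^{S+τ}‖∇u‖₂²`. Strictly WEAKER than the crux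
  (`ballIgnition_of_singularitiesDissipate`: instantiate the ball at its centre).

THEOREMS: `singularitiesDissipate_of_subs : BlowupIsL2Open → BallIgnition → SingularitiesDissipate` (the glue, pure
logic: delays add, `T + (τ₁ + τ₂) = (T + τ₁) + τ₂`); the two converses recording that the cut is EXACT modulo the
provable support `WindowStability`: `SingularitiesDissipate ↔ BlowupIsL2Open ∧ BallIgnition` given `WindowStability`
(`singularitiesDissipate_iff_subs`). HONESTY: child 2 keeps the whole analytic difficulty of the crux (post-blow-up
`ν`-uniform cascade; birth's cut applies to it verbatim); child 1 isolates the part of the crux the route does NOT need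
(a tenure planner may re-glue `closes` through `BallIgnition`: `RecurrentBlowupBall` gives the ball `B_{δ₁}(U₀)` of
blow-up data, so every smooth `V` with `‖V − U₀‖ ≤ (δ₁+δ₂)/2` is the centre of the blow-up ball of radius `(δ₁−δ₂)/2`,
and `BallIgnition` then feeds `UniformIgnition` with `δ₁ := (δ₁+δ₂)/2`). No definitions; no new facts.
-/

-- `Summit.<Summit>.<Problem>`: single-conjunct summit, the duplicate component is the tree's convention.
set_option linter.dupNamespace false

noncomputable section

open Filter Set MeasureTheory Topology

namespace Summit.AnomalousDissipation.AnomalousDissipation.Theorems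

open Summit.AnomalousDissipation.AnomalousDissipation.Theses.Sparks
open Literature.Analysis.FunctionSpaces Literature.Analysis.FluidPDE

/-- **The split glue** (bookkeeping, no analysis): `BlowupIsL2Open → BallIgnition → SingularitiesDissipate`.
Breakdown of `U₀` by `T` ⇒ (child 1) a delay `τ₁` and a radius `δ₁` such that the whole `L²`-ball `B_{δ₁}(U₀)` of smooth
divergence-free data breaks down by `T + τ₁` ⇒ (child 2 with `r := δ₁`, `S := T + τ₁`) `q, τ₂, ν₀, δ` with burn
`q ≤ ν∫₀^{(T+τ₁)+τ₂}‖∇u‖₂²` ⇒ the crux with witnesses `(q, τ₁ + τ₂, ν₀, δ)`, since `T + (τ₁ + τ₂) = (T + τ₁) + τ₂`.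
[bookkeeping] -/
theorem singularitiesDissipate_of_subs :
    (∀ f : UnitAddTorus (Fin 3) → EuclideanSpace ℝ (Fin 3), Literature.Analysis.FunctionSpaces.Torus.IsSmooth f → Literature.Analysis.FunctionSpaces.Torus.IsDivFree f → Literature.Analysis.FunctionSpaces.Torus.HasZeroMean f → ∀ (U₀ : UnitAddTorus (Fin 3) → EuclideanSpace ℝ (Fin 3)), Literature.Analysis.FunctionSpaces.Torus.IsSmooth U₀ → Literature.Analysis.FunctionSpaces.Torus.IsDivFree U₀ → ∀ (T : ℝ), 0 < T → (∀ (U : ℝ → UnitAddTorus (Fin 3) → EuclideanSpace ℝ (Fin 3)) (P : ℝ → UnitAddTorus (Fin 3) → ℝ), Literature.Analysis.FunctionSpaces.Torus.IsClassicalNSSolutionOn (Set.Icc 0 T) 0 (fun _ => f) U P → U 0 ≠ U₀) → ∃ (τ r : ℝ), 0 ≤ τ ∧ 0 < r ∧ ∀ (V : UnitAddTorus (Fin 3) → EuclideanSpace ℝ (Fin 3)), Literature.Analysis.FunctionSpaces.Torus.IsSmooth V → Literature.Analysis.FunctionSpaces.Torus.IsDivFree V → MeasureTheory.eLpNorm (V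 - U₀) 2 MeasureTheory.volume ≤ ENNReal.ofReal r → ∀ (U : ℝ → UnitAddTorus (Fin 3) → EuclideanSpace ℝ (Fin 3)) (P : ℝ → UnitAddTorus (Fin 3) → ℝ), Literature.Analysis.FunctionSpaces.Torus.IsClassicalNSSolutionOn (Set.Icc 0 (T + τ)) 0 (fun _ => f) U P → U 0 ≠ V) →
    (∀ f : UnitAddTorus (Fin 3) → EuclideanSpace ℝ (Fin 3), Literature.Analysis.FunctionSpaces.Torus.IsSmooth f → Literature.Analysis.FunctionSpaces.Torus.IsDivFree f → Literature.Analysis.FunctionSpaces.Torus.HasZeroMean f → ∀ (U₀ : UnitAddTorus (Fin 3) → EuclideanSpace ℝ (Fin 3)), Literature.Analysis.FunctionSpaces.Torus.IsSmooth U₀ → Literature.Analysis.FunctionSpaces.Torus.IsDivFree U₀ → ∀ (r S : ℝ), 0 < r → 0 < S → (∀ (V : UnitAddTorus (Fin 3) → EuclideanSpace ℝ (Fin 3)), Literature.Analysis.FunctionSpaces.Torus.IsSmooth V → Literature.Analysis.FunctionSpaces.Torus.IsDivFree V → MeasureTheory.eLpNorm (V - U₀) 2 MeasureTheory.volume ≤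 ENNReal.ofReal r → ∀ (U : ℝ → UnitAddTorus (Fin 3) → EuclideanSpace ℝ (Fin 3)) (P : ℝ → UnitAddTorus (Fin 3) → ℝ), Literature.Analysis.FunctionSpaces.Torus.IsClassicalNSSolutionOn (Set.Icc 0 S) 0 (fun _ => f) U P → U 0 ≠ V) → ∃ (q τ ν₀ δ : ℝ), 0 < q ∧ 0 ≤ τ ∧ 0 < ν₀ ∧ 0 < δ ∧ ∀ (ν : ℝ) (u₀ : UnitAddTorus (Fin 3) → EuclideanSpace ℝ (Fin 3)) (u : ℝ → UnitAddTorus (Fin 3) → EuclideanSpace ℝ (Fin 3)), 0 < ν → ν < ν₀ → Literature.Analysis.FluidPDE.Torus.IsGlobalLerayHopf ν (fun _ => f) u₀ u → MeasureTheory.MemLp u₀ 2 MeasureTheory.volume → MeasureTheory.eLpNorm (u₀ - U₀) 2 MeasureTheory.volume ≤ ENNReal.ofReal δ → q ≤ ν * (MeasureTheory.lintegral (MeasureTheory.Measure.restrict MeasureTheory.volume (Set.Ioo 0 (S + τ))) (fun t => Literature.Analysis.FunctionSpaces.Torus.eGradNormSq (u t))).toReal) →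
    Summit.AnomalousDissipation.AnomalousDissipation.Theses.Sparks.SingularitiesDissipate := by
  intro hOpen hBall
  unfold Summit.AnomalousDissipation.AnomalousDissipation.Theses.Sparks.SingularitiesDissipate
  intro f hf hfd hfm U₀ hU₀ hU₀d T hT hbreak
  -- child 1: the blow-up ball `B_{δ₁}(U₀)` with delay `τ₁`
  obtain ⟨τ₁, δ₁, hτ₁, hδ₁, hball⟩ := hOpen f hf hfd hfm U₀ hU₀ hU₀d T hT hbreak
  -- child 2 on the window `S := T + τ₁`
  have hS : 0 < T + τ₁ := by linarith
  obtain ⟨q, τ₂, ν₀, δ', hq, hτ₂, hν₀, hδ', hign⟩ := hBall f hf hfd hfm U₀ hU₀ hU₀d δ₁ (T + τ₁) hδ₁ hS hball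
  refine ⟨q, τ₁ + τ₂, ν₀, δ', hq, by linarith, hν₀, hδ', ?_⟩
  intro ν u₀ u hν hνlt hLH hmem hclose
  have h := hign ν u₀ u hν hνlt hLH hmem hclose
  rwa [← add_assoc]

/-- **Exactness, easy half: the crux implies child 2** (`SingularitiesDissipate → BallIgnition`): a ball of blow-up
data around `U₀` contains its centre (`eLpNorm (U₀ - U₀) 2 volume = 0 ≤ ofReal δ`), so `U₀` breaks down by `S` and
the crux applies verbatim with `T := S`. [bookkeeping] -/
theorem ballIgnition_of_singularitiesDissipate
    (hSD : Summit.AnomalousDissipation.AnomalousDissipation.Theses.Sparks.SingularitiesDissipate) :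
    ∀ f : UnitAddTorus (Fin 3) → EuclideanSpace ℝ (Fin 3), Literature.Analysis.FunctionSpaces.Torus.IsSmooth f → Literature.Analysis.FunctionSpaces.Torus.IsDivFree f → Literature.Analysis.FunctionSpaces.Torus.HasZeroMean f → ∀ (U₀ : UnitAddTorus (Fin 3) → EuclideanSpace ℝ (Fin 3)), Literature.Analysis.FunctionSpaces.Torus.IsSmooth U₀ → Literature.Analysis.FunctionSpaces.Torus.IsDivFree U₀ → ∀ (r S : ℝ), 0 < r → 0 < S → (∀ (V : UnitAddTorus (Fin 3) → EuclideanSpace ℝ (Fin 3)), Literature.Analysis.FunctionSpaces.Torus.IsSmooth V → Literature.Analysis.FunctionSpaces.Torus.IsDivFree V → MeasureTheory.eLpNorm (V - U₀) 2 MeasureTheory.volume ≤ ENNReal.ofReal r → ∀ (U : ℝ → UnitAddTorus (Fin 3) → EuclideanSpace ℝ (Fin 3)) (P : ℝ → UnitAddTorus (Fin 3) → ℝ), Literature.Analysis.FunctionSpaces.Torus.IsClassicalNSSolutionOn (Set.Icc 0 S) 0 (fun _ => f) U P → U 0 ≠ V) → ∃ (q τ ν₀ δ : ℝ), 0 < q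 ∧ 0 ≤ τ ∧ 0 < ν₀ ∧ 0 < δ ∧ ∀ (ν : ℝ) (u₀ : UnitAddTorus (Fin 3) → EuclideanSpace ℝ (Fin 3)) (u : ℝ → UnitAddTorus (Fin 3) → EuclideanSpace ℝ (Fin 3)), 0 < ν → ν < ν₀ → Literature.Analysis.FluidPDE.Torus.IsGlobalLerayHopf ν (fun _ => f) u₀ u → MeasureTheory.MemLp u₀ 2 MeasureTheory.volume → MeasureTheory.eLpNorm (u₀ - U₀) 2 MeasureTheory.volume ≤ ENNReal.ofReal δ → q ≤ ν * (MeasureTheory.lintegral (MeasureTheory.Measure.restrict MeasureTheory.volume (Set.Ioo 0 (S + τ))) (fun t => Literature.Analysis.FunctionSpaces.Torus.eGradNormSq (u t))).toReal := by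
  intro f hf hfd hfm U₀ hU₀ hU₀d δ S hδ hS hball
  have hcentre : MeasureTheory.eLpNorm (U₀ - U₀) 2 MeasureTheory.volume ≤ ENNReal.ofReal δ := by simp
  exact hSD f hf hfd hfm U₀ hU₀ hU₀d S hS (hball U₀ hU₀ hU₀d hcentre)

/-- **Exactness, substantive half: the crux implies child 1, given the route's support `WindowStability`**
(`WindowStability → SingularitiesDissipate → BlowupIsL2Open`; the off-centre form of the route's `BreakdownOfIgnition`,
Bruè–De Lellis 2023 §1 "anomalous dissipation … can only hold if `T` is larger than the first blow-up time"). From the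
crux at `(f, U₀, T)` take `(q, τ, ν₀, δ)`; claim the ball of radius `δ/2` breaks down by `T + τ`. If a smooth
divergence-free `V` with `‖V − U₀‖₂ ≤ δ/2` launched a classical forced-Euler solution `(U, P)` on `[0, T+τ]`, window
stability around `(U, P)` gives `C` with `ν∫₀^{T+τ}‖∇u‖₂² ≤ C(0² + ν)` for every global Leray–Hopf `u` from the datum
`V = U 0` itself (distance `0`); such a `u` exists for every `ν > 0` by Hopf's theorem on `T³` with steady smooth force
(`hopf_existence_torus_holds.steady`; `V` is in `L²` and weakly divergence free, being smooth and divergence free);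
but `V` is `δ`-close to `U₀`, so ignition forces `q ≤ C ν` for all `ν < ν₀` — false for `ν < q/(2(|C|+1))`.
[cite: BrueDeLellis2023, §1 and App. Lemma 7] -/
theorem blowupIsL2Open_of_singularitiesDissipate
    (hWS : Summit.AnomalousDissipation.AnomalousDissipation.Theses.Sparks.WindowStability)
    (hSD : Summit.AnomalousDissipation.AnomalousDissipation.Theses.Sparks.SingularitiesDissipate) :
    ∀ f : UnitAddTorus (Fin 3) → EuclideanSpace ℝ (Fin 3), Literature.Analysis.FunctionSpaces.Torus.IsSmooth f → Literature.Analysis.FunctionSpaces.Torus.IsDivFree f → Literature.Analysis.FunctionSpaces.Torus.HasZeroMean f → ∀ (U₀ : UnitAddTorus (Fin 3) → EuclideanSpace ℝ (Fin 3)), Literature.Analysis.FunctionSpaces.Torus.IsSmooth U₀ → Literature.Analysis.FunctionSpaces.Torus.IsDivFree U₀ → ∀ (T : ℝ), 0 < T → (∀ (U : ℝ → UnitAddTorus (Fin 3) → EuclideanSpace ℝ (Fin 3)) (P : ℝ → UnitAddTorus (Fin 3) → ℝ), Literature.Analysis.FunctionSpaces.Torus.IsClassicalNSSolutionOn (Set.Icc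 0 T) 0 (fun _ => f) U P → U 0 ≠ U₀) → ∃ (τ r : ℝ), 0 ≤ τ ∧ 0 < r ∧ ∀ (V : UnitAddTorus (Fin 3) → EuclideanSpace ℝ (Fin 3)), Literature.Analysis.FunctionSpaces.Torus.IsSmooth V → Literature.Analysis.FunctionSpaces.Torus.IsDivFree V → MeasureTheory.eLpNorm (V - U₀) 2 MeasureTheory.volume ≤ ENNReal.ofReal r → ∀ (U : ℝ → UnitAddTorus (Fin 3) → EuclideanSpace ℝ (Fin 3)) (P : ℝ → UnitAddTorus (Fin 3) → ℝ), Literature.Analysis.FunctionSpaces.Torus.IsClassicalNSSolutionOn (Set.Icc 0 (T + τ)) 0 (fun _ => f) U P → U 0 ≠ V := by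
  intro f hf hfd hfm U₀ hU₀ hU₀d T hT hbreak
  obtain ⟨q, τ, ν₀, δ, hq, hτ, hν₀, hδ, hign⟩ := hSD f hf hfd hfm U₀ hU₀ hU₀d T hT hbreak
  refine ⟨τ, δ / 2, hτ, by positivity, ?_⟩
  intro V hV hVd hVclose U P hUP hUV
  -- window stability around the classical solution `(U, P)` on `[0, T + τ]`
  have hTτ : 0 < T + τ := by linarith
  obtain ⟨C, hC⟩ := hWS (T + τ) hTτ f hf U P hUP
  -- a viscosity below the ignition threshold and below `q / (2 (|C| + 1))`
  set ν : ℝ := min (ν₀ / 2) (q / (2 * (|C| + 1))) with hνdef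
  have hCpos : 0 < |C| + 1 := by positivity
  have hν : 0 < ν := lt_min (by linarith) (by positivity)
  have hνlt : ν < ν₀ := lt_of_le_of_lt (min_le_left _ _) (by linarith)
  have hνq : ν ≤ q / (2 * (|C| + 1)) := min_le_right _ _
  -- Hopf: a global Leray–Hopf solution from the smooth datum `V` itself
  obtain ⟨u, hu⟩ := Literature.Analysis.FluidPDE.hopf_existence_torus_holds.steady hν hf (hV.memLp 2)
    (Literature.Analysis.FunctionSpaces.Torus.IsDivFree.isWeaklyDivFree_holds hV hVd)
  -- distance `0` to `U 0 = V`
  have hdist : MeasureTheory.eLpNorm (V - U 0) 2 MeasureTheory.volume ≤ ENNReal.ofReal 0 := by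
    simp [hUV]
  have hupper := hC ν 0 V u hν le_rfl hu (hV.memLp 2) hdist
  -- `V` is `δ`-close to `U₀`, so ignition applies to `u`
  have hVδ : MeasureTheory.eLpNorm (V - U₀) 2 MeasureTheory.volume ≤ ENNReal.ofReal δ :=
    hVclose.trans (ENNReal.ofReal_le_ofReal (by linarith))
  have hlower := hign ν V u hν hνlt hu (hV.memLp 2) hVδ
  -- `q ≤ C ν ≤ |C| ν ≤ |C| q / (2 (|C| + 1)) < q`
  have h1 : q ≤ C * ν := by nlinarith [hlower, hupper]
  have h2 : C * ν ≤ |C| * ν := mul_le_mul_of_nonneg_right (le_abs_self C) hν.le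
  have h3 : |C| * ν ≤ |C| * (q / (2 * (|C| + 1))) := mul_le_mul_of_nonneg_left hνq (abs_nonneg C)
  have h4 : |C| * (q / (2 * (|C| + 1))) < q := by
    rw [mul_div_assoc']
    rw [div_lt_iff₀ (by positivity)]
    nlinarith [abs_nonneg C]
  linarith

/-- **The cut is exact modulo `WindowStability`**: given the route's (provable) support `WindowStability`, the crux is
EQUIVALENT to the conjunction of its two children. [bookkeeping] -/
theorem singularitiesDissipate_iff_subs
    (hWS : Summit.AnomalousDissipation.AnomalousDissipation.Theses.Sparks.WindowStability) :
    Summit.AnomalousDissipation.AnomalousDissipation.Theses.Sparks.SingularitiesDissipate ↔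
    ((∀ f : UnitAddTorus (Fin 3) → EuclideanSpace ℝ (Fin 3), Literature.Analysis.FunctionSpaces.Torus.IsSmooth f → Literature.Analysis.FunctionSpaces.Torus.IsDivFree f → Literature.Analysis.FunctionSpaces.Torus.HasZeroMean f → ∀ (U₀ : UnitAddTorus (Fin 3) → EuclideanSpace ℝ (Fin 3)), Literature.Analysis.FunctionSpaces.Torus.IsSmooth U₀ → Literature.Analysis.FunctionSpaces.Torus.IsDivFree U₀ → ∀ (T : ℝ), 0 < T → (∀ (U : ℝ → UnitAddTorus (Fin 3) → EuclideanSpace ℝ (Fin 3)) (P : ℝ → UnitAddTorus (Fin 3) → ℝ), Literature.Analysis.FunctionSpaces.Torus.IsClassicalNSSolutionOn (Set.Icc 0 T) 0 (fun _ => f) U P → U 0 ≠ U₀) → ∃ (τ r : ℝ), 0 ≤ τ ∧ 0 < r ∧ ∀ (V : UnitAddTorus (Fin 3) → EuclideanSpace ℝ (Fin 3)), Literature.Analysis.FunctionSpaces.Torus.IsSmooth V → Literature.Analysis.FunctionSpaces.Torus.IsDivFree V → MeasureTheory.eLpNorm (V - U₀) 2 MeasureTheory.volume ≤ ENNReal.ofReal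 r → ∀ (U : ℝ → UnitAddTorus (Fin 3) → EuclideanSpace ℝ (Fin 3)) (P : ℝ → UnitAddTorus (Fin 3) → ℝ), Literature.Analysis.FunctionSpaces.Torus.IsClassicalNSSolutionOn (Set.Icc 0 (T + τ)) 0 (fun _ => f) U P → U 0 ≠ V) ∧
     (∀ f : UnitAddTorus (Fin 3) → EuclideanSpace ℝ (Fin 3), Literature.Analysis.FunctionSpaces.Torus.IsSmooth f → Literature.Analysis.FunctionSpaces.Torus.IsDivFree f → Literature.Analysis.FunctionSpaces.Torus.HasZeroMean f → ∀ (U₀ : UnitAddTorus (Fin 3) → EuclideanSpace ℝ (Fin 3)), Literature.Analysis.FunctionSpaces.Torus.IsSmooth U₀ → Literature.Analysis.FunctionSpaces.Torus.IsDivFree U₀ → ∀ (r S : ℝ), 0 < r → 0 < S → (∀ (V : UnitAddTorus (Fin 3) → EuclideanSpace ℝ (Fin 3)), Literature.Analysis.FunctionSpaces.Torus.IsSmooth V → Literature.Analysis.FunctionSpaces.Torus.IsDivFree V → MeasureTheory.eLpNorm (V - U₀) 2 MeasureTheory.volume ≤ ENNReal.ofReal r → ∀ (U : ℝ → UnitAddTorus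 (Fin 3) → EuclideanSpace ℝ (Fin 3)) (P : ℝ → UnitAddTorus (Fin 3) → ℝ), Literature.Analysis.FunctionSpaces.Torus.IsClassicalNSSolutionOn (Set.Icc 0 S) 0 (fun _ => f) U P → U 0 ≠ V) → ∃ (q τ ν₀ δ : ℝ), 0 < q ∧ 0 ≤ τ ∧ 0 < ν₀ ∧ 0 < δ ∧ ∀ (ν : ℝ) (u₀ : UnitAddTorus (Fin 3) → EuclideanSpace ℝ (Fin 3)) (u : ℝ → UnitAddTorus (Fin 3) → EuclideanSpace ℝ (Fin 3)), 0 < ν → ν < ν₀ → Literature.Analysis.FluidPDE.Torus.IsGlobalLerayHopf ν (fun _ => f) u₀ u → MeasureTheory.MemLp u₀ 2 MeasureTheory.volume → MeasureTheory.eLpNorm (u₀ - U₀) 2 MeasureTheory.volume ≤ ENNReal.ofReal δ → q ≤ ν * (MeasureTheory.lintegral (MeasureTheory.Measure.restrict MeasureTheory.volume (Set.Ioo 0 (S + τ))) (fun t => Literature.Analysis.FunctionSpaces.Torus.eGradNormSq (u t))).toReal)) :=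
  ⟨fun h => ⟨blowupIsL2Open_of_singularitiesDissipate hWS h, ballIgnition_of_singularitiesDissipate h⟩,
    fun h => singularitiesDissipate_of_subs h.1 h.2⟩

end Summit.AnomalousDissipation.AnomalousDissipation.Theorems

end
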